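import Summits.QuantumFields.YangMills.Theorems.ColdStartUniversalityLatticeLangevinLiebRobinsonCarreOfLipschitz
import Summits.QuantumFields.YangMills.Theorems.ColdStartUniversalityLatticeLangevinNoiseFrameParseval
import Literature.MathematicalPhysics.QuantumFieldTheory.SUNBakryEmeryFrameConjugation
import HarnessLib

/-!
# Route `ColdStartUniversality` (fixed-cut-off package): the SHARP carré-du-champ bound from a link-Lipschitz profile —
# `Γ^A(u)(V) ≤ 2·Σ_e ℓ_e²`, i.e. `|∇_e F|²_{HS} ≤ ℓ_e²` link by link (Shen–Zhu–Zhu's "chords are shorter than arcs" step)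

Helper file (seat `ym-line-csu-p1`, g38; `--supports stmt-QuantumFields-24809`).  The g30 bound `carre_le_of_linkLipschitz` estimates each of
the `8` noise-frame derivatives per link separately (`|W_(e,ν)u| ≤ √2·ℓ_e`) and gets `Γ^A(u) ≤ 16·Σ_e ℓ_e²`.  The frame `(√2·𝐩(E_ν)·Q)_ν` is a
(redundant) PARSEVAL frame of the tangent space `𝔰𝔲(2)·Q` for the Hilbert–Schmidt metric, so the sharp count is
`Σ_ν (W_(e,ν)u)² = 2·‖∇_e^{HS}(u∘coords)‖² ≤ 2·ℓ_e²`: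
* `sum_sq_apply_frame_le_of_skew` — the frame trick of `Literature…SUNBakryEmery.sum_sq_apply_frame_le` with the Lipschitz hypothesis asked
  only on `𝔰𝔲(N)` (skew-Hermitian traceless directions): `(∀ A ∈ 𝔰𝔲(N), |λ(A)| ≤ M‖A‖_F) ⇒ Σ_α λ(Y_α)² ≤ M²`;
* ★ `dirDeriv_abs_le_of_linkLipschitz` — for EVERY `Y ∈ 𝔰𝔲(2)`: `|Du(coords V)[δ_e(Y·Q_e)]| ≤ ℓ_e·‖Y‖_F` (move the link along `s ↦ e^(sY)V_e`,
  `hasDerivAt_comp_coords_multiFlow`; `‖e^(sY) − 1‖_F ≤ s‖Y‖_F`);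
* ★★ `sum_frameDeriv_sq_le_of_linkLipschitz` — the per-link count `Σ_ν (W_(e,ν)u)² ≤ 2ℓ_e²` (the noise/Parseval-frame identity
  `sum_sq_apply_noise_eq_two_mul_sum_sq_apply_mul_frame`, left/right invariance `sum_sq_apply_frame_mul_eq_sum_sq_apply_mul_frame`);
  summed over the links with the frame dictionary `carre_eq_sum_frameDeriv_mul` it gives `Γ^A(u)(V) ≤ 2·Σ_e ℓ_e²` (done where used, in the
  sequel; the g30 file `…LiebRobinsonCarreOfLipschitz` has the same statement with `16` in place of `2`).
With the energy identity `−∫F·𝓛f = ½∫Γ^A(f)` this is exactly the constant of Shen–Zhu–Zhu's Lipschitz form of (4.11)–(4.13): `Var ≤ K⁻¹Σℓ_e²`,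
`Ent(F²) ≤ 2K⁻¹Σℓ_e²` (sequel file).  THEOREMS ONLY, no definition, no sorry; [folklore] linear algebra.  HONEST FRAMING: fixed cut-off
bookkeeping; no crux, rung or summit statement is proved; the Yang–Mills mass gap is NOT proved.
-/

set_option autoImplicit false

noncomputable section

namespace Summit.QuantumFields.YangMills.Theorems.ColdStartUniversality

open MeasureTheory ProbabilityTheory Matrix Complex Finset Filter Set Metric
open scoped ComplexConjugate BigOperators Matrix NNReal ENNReal Topology
open Literature.Probability.Process Literature.MathematicalPhysics.QuantumFieldTheory
open Literature.MathematicalPhysics.QuantumLattice (fundamentalRep fundamentalLatticeRep continuous_fundamentalRep fundamentalRep_apply)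

variable {L : ℕ} [NeZero L]

/-! ## §1. The frame trick with the Lipschitz hypothesis on `𝔰𝔲(N)` only -/

/-- **The frame trick, `𝔰𝔲(N)`-restricted**: if `|λ(A)| ≤ M ‖A‖_F` for all skew-Hermitian traceless `A`, then `∑_α λ(Y_α)² ≤ M²`
(the Riesz representer `Z_λ = Σ_α λ(Y_α)Y_α` of `λ|_{𝔰𝔲(N)}` in the Parseval frame lies in `𝔰𝔲(N)` and `Σ_α λ(Y_α)² = λ(Z_λ) ≤ M‖Z_λ‖_F`,
`‖Z_λ‖_F² = Σ_α λ(Y_α)²`). [folklore] -/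
theorem sum_sq_apply_frame_le_of_skew {N : ℕ} (hN : N ≠ 0) (lam : Matrix (Fin N) (Fin N) ℂ →ₗ[ℝ] ℝ) {M : ℝ}
    (h : ∀ A : Matrix (Fin N) (Fin N) ℂ, Aᴴ = -A → A.trace = 0 → |lam A| ≤ M * frobNorm A) :
    ∑ α, lam (SUNBakryEmery.frame α) ^ 2 ≤ M ^ 2 := by
  set s := ∑ α, lam (SUNBakryEmery.frame α) ^ 2 with hs
  have hs0 : 0 ≤ s := sum_nonneg fun α _ => sq_nonneg _
  have h1 : s ≤ M * Real.sqrt s := by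
    calc s = lam (SUNBakryEmery.frameGrad lam) := SUNBakryEmery.sum_sq_apply_frame lam
      _ ≤ |lam (SUNBakryEmery.frameGrad lam)| := le_abs_self _
      _ ≤ M * frobNorm (SUNBakryEmery.frameGrad lam) :=
          h _ (SUNBakryEmery.frameGrad_conjTranspose lam) (SUNBakryEmery.frameGrad_trace hN lam)
      _ = M * Real.sqrt s := by
          rw [← Real.sqrt_sq (frobNorm_nonneg (SUNBakryEmery.frameGrad lam)), SUNBakryEmery.frobNorm_frameGrad_sq hN]
  have h2 : Real.sqrt s * Real.sqrt s ≤ M * Real.sqrt s := by rwa [Real.mul_self_sqrt hs0]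
  by_cases hs1 : Real.sqrt s = 0
  · have : s = 0 := by rwa [Real.sqrt_eq_zero hs0] at hs1
    rw [this]; positivity
  · have hpos : 0 < Real.sqrt s := lt_of_le_of_ne (Real.sqrt_nonneg s) (Ne.symm hs1)
    have h3 : Real.sqrt s ≤ M := le_of_mul_le_mul_right h2 hpos
    calc s = Real.sqrt s ^ 2 := (Real.sq_sqrt hs0).symm
      _ ≤ M ^ 2 := pow_le_pow_left₀ (Real.sqrt_nonneg s) h3 2

/-! ## §2. Directional derivatives along `𝔰𝔲(2)·Q_e` from a link-Lipschitz constant -/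

section Frame

open scoped Matrix.Norms.Operator

/-- ★ **Tangential derivatives from a link-Lipschitz constant.**  If `u` is `C¹` and `u∘coords` is `ℓ`-Lipschitz in the link `e` for the
Frobenius distance (all other links frozen), then for EVERY `Y ∈ 𝔰𝔲(2)` (skew-Hermitian, traceless) and every configuration `V`:
`|Du(coords V)[δ_e(Y·Q_e)]| ≤ ℓ·‖Y‖_F`, `Q_e = ρ(V_e)` — the derivative of `u∘coords` along the curve `s ↦ e^(sY)·_e V`, whose chordal speed
is `‖Y Q_e‖_F = ‖Y‖_F`. [folklore] -/
theorem dirDeriv_abs_le_of_linkLipschitz {u : (Edge 3 L × Fin 2 × Fin 2 × Bool → ℝ) → ℝ} (hu : ContDiff ℝ 1 u) (e : Edge 3 L)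
    {Y : Matrix (Fin (fundamentalLatticeRep 2).N) (Fin (fundamentalLatticeRep 2).N) ℂ} (hY : Yᴴ = -Y) (hY0 : Y.trace = 0) {ℓ : ℝ} (hℓ : 0 ≤ ℓ)
    (hLip : ∀ y y' : (GaugeConfig 3 L (Matrix.specialUnitaryGroup (Fin 2) ℂ)), (∀ f, f ≠ e → y f = y' f) →
      |u ((fun (V : GaugeConfig 3 L (Matrix.specialUnitaryGroup (Fin 2) ℂ)) (q : Edge 3 L × Fin (fundamentalLatticeRep 2).N × Fin (fundamentalLatticeRep 2).N × Bool) => (fun z : ℂ => if q.2.2.2 then z.im else z.re) ((fundamentalRep (Fin 2) (V q.1) : Matrix (Fin 2) (Fin 2) ℂ) q.2.1 q.2.2.1)) y) - u ((fun (V : GaugeConfig 3 L (Matrix.specialUnitaryGroup (Fin 2) ℂ)) (q : Edge 3 L × Fin (fundamentalLatticeRep 2).N × Fin (fundamentalLatticeRep 2).N × Bool) => (fun z : ℂ => if q.2.2.2 then z.im else z.re) ((fundamentalRep (Fin 2) (V q.1) : Matrix (Fin 2) (Fin 2) ℂ) q.2.1 q.2.2.1)) y')| ≤ ℓ * frobNorm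 ((y e : Matrix (Fin 2) (Fin 2) ℂ) - (y' e : Matrix (Fin 2) (Fin 2) ℂ)))
    (V : (GaugeConfig 3 L (Matrix.specialUnitaryGroup (Fin 2) ℂ))) :
    |fderiv ℝ u ((fun (V : GaugeConfig 3 L (Matrix.specialUnitaryGroup (Fin 2) ℂ)) (q : Edge 3 L × Fin (fundamentalLatticeRep 2).N × Fin (fundamentalLatticeRep 2).N × Bool) => (fun z : ℂ => if q.2.2.2 then z.im else z.re) ((fundamentalRep (Fin 2) (V q.1) : Matrix (Fin 2) (Fin 2) ℂ) q.2.1 q.2.2.1)) V) (fun q : Edge 3 L × Fin (fundamentalLatticeRep 2).N × Fin (fundamentalLatticeRep 2).N × Bool => if e = q.1 then (fun z : ℂ => if q.2.2.2 then z.im else z.re) ((Y * (fundamentalLatticeRep 2).ρ (V e)) q.2.1 q.2.2.1) else 0)| ≤ ℓ * frobNorm Y := by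
  classical
  have hud : Differentiable ℝ u := hu.differentiable (by norm_num)
  have hLip' : ∀ y y' : (GaugeConfig 3 L (Matrix.specialUnitaryGroup (Fin 2) ℂ)), (∀ f, f ≠ e → y f = y' f) →
      |u ((fun (V : GaugeConfig 3 L (Matrix.specialUnitaryGroup (Fin 2) ℂ)) (q : Edge 3 L × Fin (fundamentalLatticeRep 2).N × Fin (fundamentalLatticeRep 2).N × Bool) => (fun z : ℂ => if q.2.2.2 then z.im else z.re) ((fundamentalRep (Fin 2) (V q.1) : Matrix (Fin 2) (Fin 2) ℂ) q.2.1 q.2.2.1)) y) - u ((fun (V : GaugeConfig 3 L (Matrix.specialUnitaryGroup (Fin 2) ℂ)) (q : Edge 3 L × Fin (fundamentalLatticeRep 2).N × Fin (fundamentalLatticeRep 2).N × Bool) => (fun z : ℂ => if q.2.2.2 then z.im else z.re) ((fundamentalRep (Fin 2) (V q.1) : Matrix (Fin 2) (Fin 2) ℂ) q.2.1 q.2.2.1)) y')| ≤ ℓ * frobNorm ((fundamentalLatticeRep 2).ρ (y e) - (fundamentalLatticeRep 2).ρ (y' e)) :=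
    fun y y' h => hLip y y' h
  -- the generator `Y`, placed at the link `e`
  set X : Edge 3 L → Matrix (Fin (fundamentalLatticeRep 2).N) (Fin (fundamentalLatticeRep 2).N) ℂ := fun f => if f = e then Y else 0 with hXdef
  have hXskew : ∀ f, (X f)ᴴ = -(X f) := fun f => by
    by_cases hf : f = e
    · simp only [hXdef, hf, if_true]; exact hY
    · simp only [hXdef, hf, if_false, Matrix.conjTranspose_zero, neg_zero]
  have hXtr : ∀ f, (X f).trace = 0 := fun f => by
    by_cases hf : f = e
    · simp only [hXdef, hf, if_true]; exact hY0
    · simp only [hXdef, hf, if_false, Matrix.trace_zero]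
  set us : ℝ → (GaugeConfig 3 L (Matrix.specialUnitaryGroup (Fin 2) ℂ)) := fun s => (fun f => SUNBakryEmery.expSU (N := 2) (Y := Matrix.of fun i j : Fin 2 => X f i j) (hXskew f) (hXtr f) s) with hus
  have hus0 : us 0 * V = V := by
    funext f
    have h1 : (SUNBakryEmery.expSU (N := 2) (Y := Matrix.of fun i j : Fin 2 => X f i j) (hXskew f) (hXtr f) (0 : ℝ)) = 1 :=
      Subtype.ext (by rw [SUNBakryEmery.coe_expSU, zero_smul, NormedSpace.exp_zero]; rfl)
    simp only [hus, Pi.mul_apply, h1, one_mul]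
  -- the other links do not move
  have hfix : ∀ (s : ℝ) (f : Edge 3 L), f ≠ e → (us s * V) f = V f := by
    intro s f hf
    have h1 : (SUNBakryEmery.expSU (N := 2) (Y := Matrix.of fun i j : Fin 2 => X f i j) (hXskew f) (hXtr f) s) = 1 := by
      apply Subtype.ext
      rw [SUNBakryEmery.coe_expSU]
      have hz : (Matrix.of fun i j : Fin 2 => X f i j) = 0 := by
        ext i j; simp only [hXdef, hf, if_false, Matrix.of_apply]; rfl
      rw [hz, smul_zero, NormedSpace.exp_zero]; rfl
    simp only [hus, Pi.mul_apply, h1, one_mul]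
  -- the moving link: `(us s * V) e = e^(sY) V_e`
  have hmove : ∀ s : ℝ, (fundamentalLatticeRep 2).ρ ((us s * V) e) =
      NormedSpace.exp (s • Y) * (fundamentalLatticeRep 2).ρ (V e) := by
    intro s
    have hof : (Matrix.of fun i j : Fin 2 => X e i j) = Y := by
      ext i j; simp only [hXdef, if_true, Matrix.of_apply]
    show (fundamentalLatticeRep 2).ρ ((us s) e * V e) = _
    rw [map_mul]
    congr 1
    show ((SUNBakryEmery.expSU (N := 2) (Y := Matrix.of fun i j : Fin 2 => X e i j) (hXskew e) (hXtr e) s :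
      Matrix.specialUnitaryGroup (Fin 2) ℂ) : Matrix (Fin 2) (Fin 2) ℂ) = _
    rw [SUNBakryEmery.coe_expSU, hof]
    rfl
  -- the derivative of `φ(s) = u(coords(us s · V))` at `0` is `Du(coords V)[δ_e(Y Q_e)]`
  set φ : ℝ → ℝ := fun s => u ((fun (V : GaugeConfig 3 L (Matrix.specialUnitaryGroup (Fin 2) ℂ)) (q : Edge 3 L × Fin (fundamentalLatticeRep 2).N × Fin (fundamentalLatticeRep 2).N × Bool) => (fun z : ℂ => if q.2.2.2 then z.im else z.re) ((fundamentalRep (Fin 2) (V q.1) : Matrix (Fin 2) (Fin 2) ℂ) q.2.1 q.2.2.1)) (us s * V)) with hφ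
  have hder := hasDerivAt_comp_coords_multiFlow (L := L) X hXskew hXtr V hud 0
  have hreb := rebuild_coords_of (L := L) V
  have hdir : (fun q : Edge 3 L × Fin (fundamentalLatticeRep 2).N × Fin (fundamentalLatticeRep 2).N × Bool => (fun z : ℂ => if q.2.2.2 then z.im else z.re) ((X q.1 * (fun (ee : Edge 3 L) => Matrix.of fun (i j : Fin (fundamentalLatticeRep 2).N) => (((fun (V : GaugeConfig 3 L (Matrix.specialUnitaryGroup (Fin 2) ℂ)) (q : Edge 3 L × Fin (fundamentalLatticeRep 2).N × Fin (fundamentalLatticeRep 2).N × Bool) => (fun z : ℂ => if q.2.2.2 then z.im else z.re) ((fundamentalRep (Fin 2) (V q.1) : Matrix (Fin 2) (Fin 2) ℂ) q.2.1 q.2.2.1)) (us 0 * V) (ee, i, j, false) : ℝ) : ℂ) + (((fun (V : GaugeConfig 3 L (Matrix.specialUnitaryGroup (Fin 2) ℂ)) (q : Edge 3 L × Fin (fundamentalLatticeRep 2).N × Fin (fundamentalLatticeRep 2).N × Bool) => (fun z : ℂ => if q.2.2.2 then z.im else z.re) ((fundamentalRep (Fin 2) (V q.1) : Matrix (Fin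 2) (Fin 2) ℂ) q.2.1 q.2.2.1)) (us 0 * V) (ee, i, j, true) : ℝ) : ℂ) * Complex.I) q.1) q.2.1 q.2.2.1)) =
      (fun q : Edge 3 L × Fin (fundamentalLatticeRep 2).N × Fin (fundamentalLatticeRep 2).N × Bool => if e = q.1 then (fun z : ℂ => if q.2.2.2 then z.im else z.re) ((Y * (fundamentalLatticeRep 2).ρ (V e)) q.2.1 q.2.2.1) else 0) := by
    rw [hus0]
    funext q
    by_cases hq : e = q.1
    · rw [if_pos hq]
      have hXq : X q.1 = Y := by rw [hXdef]; exact if_pos hq.symm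
      have hRq : (fun (ee : Edge 3 L) => Matrix.of fun (i j : Fin (fundamentalLatticeRep 2).N) => (((fun (V : GaugeConfig 3 L (Matrix.specialUnitaryGroup (Fin 2) ℂ)) (q : Edge 3 L × Fin (fundamentalLatticeRep 2).N × Fin (fundamentalLatticeRep 2).N × Bool) => (fun z : ℂ => if q.2.2.2 then z.im else z.re) ((fundamentalRep (Fin 2) (V q.1) : Matrix (Fin 2) (Fin 2) ℂ) q.2.1 q.2.2.1)) V (ee, i, j, false) : ℝ) : ℂ) + (((fun (V : GaugeConfig 3 L (Matrix.specialUnitaryGroup (Fin 2) ℂ)) (q : Edge 3 L × Fin (fundamentalLatticeRep 2).N × Fin (fundamentalLatticeRep 2).N × Bool) => (fun z : ℂ => if q.2.2.2 then z.im else z.re) ((fundamentalRep (Fin 2) (V q.1) : Matrix (Fin 2) (Fin 2) ℂ) q.2.1 q.2.2.1)) V (ee, i, j, true) : ℝ) : ℂ) * Complex.I) q.1 = (fundamentalLatticeRep 2).ρ (V q.1) := congrFun hreb q.1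
      rw [hXq, hRq, ← hq]
    · rw [if_neg hq]
      have hXq : X q.1 = 0 := by rw [hXdef]; exact if_neg (fun h => hq h.symm)
      rw [hXq, Matrix.zero_mul]
      simp
  have hφder : HasDerivAt φ (fderiv ℝ u ((fun (V : GaugeConfig 3 L (Matrix.specialUnitaryGroup (Fin 2) ℂ)) (q : Edge 3 L × Fin (fundamentalLatticeRep 2).N × Fin (fundamentalLatticeRep 2).N × Bool) => (fun z : ℂ => if q.2.2.2 then z.im else z.re) ((fundamentalRep (Fin 2) (V q.1) : Matrix (Fin 2) (Fin 2) ℂ) q.2.1 q.2.2.1)) V) (fun q : Edge 3 L × Fin (fundamentalLatticeRep 2).N × Fin (fundamentalLatticeRep 2).N × Bool => if e = q.1 then (fun z : ℂ => if q.2.2.2 then z.im else z.re) ((Y * (fundamentalLatticeRep 2).ρ (V e)) q.2.1 q.2.2.1) else 0)) 0 := by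
    have h := hder
    rw [hdir, hus0] at h
    exact h
  -- Lipschitz bound on the slopes: `|φ(s) − φ(0)| ≤ ℓ ‖e^(sY) − 1‖_F ≤ ℓ·s·‖Y‖_F`
  obtain ⟨T, hT⟩ : ∃ T : Matrix (Fin (fundamentalLatticeRep 2).N) (Fin (fundamentalLatticeRep 2).N) ℂ →L[ℝ] EuclideanSpace ℂ (Fin (fundamentalLatticeRep 2).N × Fin (fundamentalLatticeRep 2).N), ∀ M, ‖T M‖ = frobNorm M := by
    let Tl : Matrix (Fin (fundamentalLatticeRep 2).N) (Fin (fundamentalLatticeRep 2).N) ℂ →ₗ[ℝ] EuclideanSpace ℂ (Fin (fundamentalLatticeRep 2).N × Fin (fundamentalLatticeRep 2).N) :=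
      { toFun := fun M => WithLp.toLp 2 (fun kl => M kl.1 kl.2)
        map_add' := fun v w => rfl
        map_smul' := fun c v => rfl }
    refine ⟨LinearMap.toContinuousLinearMap Tl, fun M => ?_⟩
    rw [LinearMap.coe_toContinuousLinearMap', EuclideanSpace.norm_eq, frobNorm]
    congr 1
    rw [Fintype.sum_prod_type]
    rfl
  have hXu : ∀ r : ℝ, NormedSpace.exp (r • Y) ∈ Matrix.unitaryGroup (Fin (fundamentalLatticeRep 2).N) ℂ := fun r =>
    Matrix.specialUnitaryGroup_le_unitaryGroup (SUNBakryEmery.expSU (N := 2) hY hY0 r).2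
  have hEder : ∀ r : ℝ, HasDerivAt (fun r : ℝ => T (NormedSpace.exp (r • Y))) (T (Y * NormedSpace.exp (r • Y))) r := fun r =>
    T.hasFDerivAt.comp_hasDerivAt r (hasDerivAt_exp_smul_const' (𝕂 := ℝ) Y r)
  have hEbound : ∀ s : ℝ, 0 ≤ s → frobNorm (NormedSpace.exp (s • Y) - 1) ≤ s * frobNorm Y := by
    intro s hs
    have hMV := norm_image_sub_le_of_norm_deriv_le_segment' (f := fun r : ℝ => T (NormedSpace.exp (r • Y))) (a := (0 : ℝ)) (b := s)
      (C := frobNorm Y) (fun r _ => (hEder r).hasDerivWithinAt)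
      (fun r _ => by rw [hT, frobNorm_mul_unitary _ (hXu r)]) s (Set.right_mem_Icc.2 hs)
    rw [← map_sub, hT, zero_smul, NormedSpace.exp_zero, sub_zero] at hMV
    rw [mul_comm]; exact hMV
  have hslope : ∀ s : ℝ, 0 < s → |slope φ 0 s| ≤ ℓ * frobNorm Y := by
    intro s hs
    have hu0 : (fundamentalLatticeRep 2).ρ (V e) ∈ Matrix.unitaryGroup (Fin (fundamentalLatticeRep 2).N) ℂ :=
      Matrix.specialUnitaryGroup_le_unitaryGroup (V e).2
    have h1 : |φ s - φ 0| ≤ ℓ * frobNorm (NormedSpace.exp (s • Y) - 1) := by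
      have h := hLip' (us s * V) V (fun f hf => hfix s f hf)
      rw [hmove s] at h
      have hfrob : frobNorm (NormedSpace.exp (s • Y) * (fundamentalLatticeRep 2).ρ (V e) -
          (fundamentalLatticeRep 2).ρ (V e)) = frobNorm (NormedSpace.exp (s • Y) - 1) := by
        rw [show NormedSpace.exp (s • Y) * (fundamentalLatticeRep 2).ρ (V e) -
            (fundamentalLatticeRep 2).ρ (V e) =
          (NormedSpace.exp (s • Y) - 1) * (fundamentalLatticeRep 2).ρ (V e) by rw [Matrix.sub_mul, Matrix.one_mul],
          frobNorm_mul_unitary _ hu0]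
      rw [hfrob] at h
      simpa only [hφ, hus0] using h
    rw [slope_def_field, sub_zero, abs_div, abs_of_pos hs, div_le_iff₀ hs]
    calc |φ s - φ 0| ≤ ℓ * frobNorm (NormedSpace.exp (s • Y) - 1) := h1
      _ ≤ ℓ * (s * frobNorm Y) := mul_le_mul_of_nonneg_left (hEbound s hs.le) hℓ
      _ = ℓ * frobNorm Y * s := by ring
  -- pass to the limit `s → 0⁺`
  have htend : Tendsto (fun s => |slope φ 0 s|) (𝓝[>] (0 : ℝ)) (𝓝 |fderiv ℝ u ((fun (V : GaugeConfig 3 L (Matrix.specialUnitaryGroup (Fin 2) ℂ)) (q : Edge 3 L × Fin (fundamentalLatticeRep 2).N × Fin (fundamentalLatticeRep 2).N × Bool) => (fun z : ℂ => if q.2.2.2 then z.im else z.re) ((fundamentalRep (Fin 2) (V q.1) : Matrix (Fin 2) (Fin 2) ℂ) q.2.1 q.2.2.1)) V) (fun q : Edge 3 L × Fin (fundamentalLatticeRep 2).N × Fin (fundamentalLatticeRep 2).N × Bool => if e = q.1 then (fun z : ℂ => if q.2.2.2 then z.im else z.re) ((Y * (fundamentalLatticeRep 2).ρ (V e)) q.2.1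 q.2.2.1) else 0)|) :=
    ((hφder.tendsto_slope.mono_left (nhdsWithin_mono _ fun s (hs : 0 < s) => ne_of_gt hs))).abs
  exact le_of_tendsto htend (eventually_nhdsWithin_of_forall fun s hs => hslope s hs)

end Frame

/-! ## §3. The sharp per-link count `Σ_ν (W_(e,ν)u)² ≤ 2ℓ_e²` -/

/-- ★★ **Sharp per-link frame count.**  If `u` is `C¹` and `u∘coords` is `ℓ`-Lipschitz in the link `e` (Frobenius distance, other links
frozen), then at every configuration `V` the `8` noise-frame derivatives at `e` satisfy `Σ_ν (W_(e,ν)u(coords V))² ≤ 2·ℓ²`: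
`Σ_ν λ(√2𝐩(E_ν)Q_e)² = 2Σ_α λ(Q_eY_α)² = 2Σ_α λ(Y_αQ_e)²` for `λ(A) = Du(coords V)[δ_e(A)]` (noise basis vs Parseval frame of `𝔰𝔲(2)`,
left/right invariance) and `Σ_α λ(Y_αQ_e)² ≤ ℓ²` by the `𝔰𝔲(2)`-restricted frame trick with `dirDeriv_abs_le_of_linkLipschitz` — i.e.
`|∇_e(u∘coords)|²_{HS} ≤ ℓ²` ("chords are shorter than arcs"). [cite: ShenZhuZhu2022, §2 (2.3)–(2.4) (p. 10)] -/
theorem sum_frameDeriv_sq_le_of_linkLipschitz {u : (Edge 3 L × Fin 2 × Fin 2 × Bool → ℝ) → ℝ} (hu : ContDiff ℝ 1 u) (e : Edge 3 L) {ℓ : ℝ} (hℓ : 0 ≤ ℓ)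
    (hLip : ∀ y y' : (GaugeConfig 3 L (Matrix.specialUnitaryGroup (Fin 2) ℂ)), (∀ f, f ≠ e → y f = y' f) →
      |u ((fun (V : GaugeConfig 3 L (Matrix.specialUnitaryGroup (Fin 2) ℂ)) (q : Edge 3 L × Fin (fundamentalLatticeRep 2).N × Fin (fundamentalLatticeRep 2).N × Bool) => (fun z : ℂ => if q.2.2.2 then z.im else z.re) ((fundamentalRep (Fin 2) (V q.1) : Matrix (Fin 2) (Fin 2) ℂ) q.2.1 q.2.2.1)) y) - u ((fun (V : GaugeConfig 3 L (Matrix.specialUnitaryGroup (Fin 2) ℂ)) (q : Edge 3 L × Fin (fundamentalLatticeRep 2).N × Fin (fundamentalLatticeRep 2).N × Bool) => (fun z : ℂ => if q.2.2.2 then z.im else z.re) ((fundamentalRep (Fin 2) (V q.1) : Matrix (Fin 2) (Fin 2) ℂ) q.2.1 q.2.2.1)) y')| ≤ ℓ * frobNorm ((y e : Matrix (Fin 2) (Fin 2) ℂ) - (y' e : Matrix (Fin 2) (Fin 2) ℂ)))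
    (V : (GaugeConfig 3 L (Matrix.specialUnitaryGroup (Fin 2) ℂ))) :
    ∑ ν : NoiseIdx (fundamentalLatticeRep 2).N,
        fderiv ℝ u ((fun (V : GaugeConfig 3 L (Matrix.specialUnitaryGroup (Fin 2) ℂ)) (q : Edge 3 L × Fin (fundamentalLatticeRep 2).N × Fin (fundamentalLatticeRep 2).N × Bool) => (fun z : ℂ => if q.2.2.2 then z.im else z.re) ((fundamentalRep (Fin 2) (V q.1) : Matrix (Fin 2) (Fin 2) ℂ) q.2.1 q.2.2.1)) V) (fun q : Edge 3 L × Fin (fundamentalLatticeRep 2).N × Fin (fundamentalLatticeRep 2).N × Bool => if (e, ν).1 = q.1 then (fun z : ℂ => if q.2.2.2 then z.im else z.re) (((Real.sqrt 2 : ℂ) • ((fundamentalLatticeRep 2).lieProj (noiseDir (e, ν).2) * (fun (ee : Edge 3 L) => Matrix.of fun (i j : Fin (fundamentalLatticeRep 2).N) => (((fun (V : GaugeConfig 3 L (Matrix.specialUnitaryGroup (Fin 2) ℂ)) (q : Edge 3 L × Fin (fundamentalLatticeRep 2).N × Fin (fundamentalLatticeRep 2).N × Bool) => (fun z : ℂ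 => if q.2.2.2 then z.im else z.re) ((fundamentalRep (Fin 2) (V q.1) : Matrix (Fin 2) (Fin 2) ℂ) q.2.1 q.2.2.1)) V (ee, i, j, false) : ℝ) : ℂ) + (((fun (V : GaugeConfig 3 L (Matrix.specialUnitaryGroup (Fin 2) ℂ)) (q : Edge 3 L × Fin (fundamentalLatticeRep 2).N × Fin (fundamentalLatticeRep 2).N × Bool) => (fun z : ℂ => if q.2.2.2 then z.im else z.re) ((fundamentalRep (Fin 2) (V q.1) : Matrix (Fin 2) (Fin 2) ℂ) q.2.1 q.2.2.1)) V (ee, i, j, true) : ℝ) : ℂ) * Complex.I) q.1)) q.2.1 q.2.2.1) else 0) * fderiv ℝ u ((fun (V : GaugeConfig 3 L (Matrix.specialUnitaryGroup (Fin 2) ℂ)) (q : Edge 3 L × Fin (fundamentalLatticeRep 2).N × Fin (fundamentalLatticeRep 2).N × Bool) => (fun z : ℂ => if q.2.2.2 then z.im else z.re) ((fundamentalRep (Fin 2) (V q.1) : Matrix (Fin 2) (Fin 2) ℂ) q.2.1 q.2.2.1)) V) (fun q : Edge 3 L × Fin (fundamentalLatticeRep 2).N × Fin (fundamentalLatticeRep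 2).N × Bool => if (e, ν).1 = q.1 then (fun z : ℂ => if q.2.2.2 then z.im else z.re) (((Real.sqrt 2 : ℂ) • ((fundamentalLatticeRep 2).lieProj (noiseDir (e, ν).2) * (fun (ee : Edge 3 L) => Matrix.of fun (i j : Fin (fundamentalLatticeRep 2).N) => (((fun (V : GaugeConfig 3 L (Matrix.specialUnitaryGroup (Fin 2) ℂ)) (q : Edge 3 L × Fin (fundamentalLatticeRep 2).N × Fin (fundamentalLatticeRep 2).N × Bool) => (fun z : ℂ => if q.2.2.2 then z.im else z.re) ((fundamentalRep (Fin 2) (V q.1) : Matrix (Fin 2) (Fin 2) ℂ) q.2.1 q.2.2.1)) V (ee, i, j, false) : ℝ) : ℂ) + (((fun (V : GaugeConfig 3 L (Matrix.specialUnitaryGroup (Fin 2) ℂ)) (q : Edge 3 L × Fin (fundamentalLatticeRep 2).N × Fin (fundamentalLatticeRep 2).N × Bool) => (fun z : ℂ => if q.2.2.2 then z.im else z.re) ((fundamentalRep (Fin 2) (V q.1) : Matrix (Fin 2) (Fin 2) ℂ) q.2.1 q.2.2.1)) V (ee, i, j, true) : ℝ) : ℂ) * Complex.I) q.1)) q.2.1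 q.2.2.1) else 0) ≤ 2 * ℓ ^ 2 := by
  classical
  have hN : (fundamentalLatticeRep 2).N ≠ 0 := by rw [Literature.MathematicalPhysics.QuantumLattice.fundamentalLatticeRep_N]; norm_num
  -- `Q = Q_e`, the embedding `δ_e`, the functional `λ = Du(coords V) ∘ δ_e`
  set Q : Matrix (Fin (fundamentalLatticeRep 2).N) (Fin (fundamentalLatticeRep 2).N) ℂ := (fundamentalLatticeRep 2).ρ (V e) with hQdef
  have hQu : Q ∈ Matrix.unitaryGroup (Fin (fundamentalLatticeRep 2).N) ℂ := Matrix.specialUnitaryGroup_le_unitaryGroup (V e).2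
  have hQ1 : Q * Qᴴ = 1 := by
    have h := Matrix.mem_unitaryGroup_iff.1 hQu
    rwa [Matrix.star_eq_conjTranspose] at h
  have hQ2 : Qᴴ * Q = 1 := by
    have h := Matrix.mem_unitaryGroup_iff'.1 hQu
    rwa [Matrix.star_eq_conjTranspose] at h
  set ι : Matrix (Fin (fundamentalLatticeRep 2).N) (Fin (fundamentalLatticeRep 2).N) ℂ → (Edge 3 L × Fin (fundamentalLatticeRep 2).N × Fin (fundamentalLatticeRep 2).N × Bool → ℝ) := fun M q =>
    if e = q.1 then (fun z : ℂ => if q.2.2.2 then z.im else z.re) (M q.2.1 q.2.2.1) else 0 with hιdef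
  have hιadd : ∀ M M', ι (M + M') = ι M + ι M' := by
    intro M M'; funext q; obtain ⟨e', i, j, b⟩ := q
    rw [Pi.add_apply]
    by_cases h : e = e' <;> cases b <;>
      simp only [hιdef, h, if_true, if_false, Bool.false_eq_true, Matrix.add_apply, Complex.add_re,
        Complex.add_im, add_zero]
  have hιsmul : ∀ (a : ℝ) M, ι (a • M) = a • ι M := by
    intro a M; funext q; obtain ⟨e', i, j, b⟩ := q
    rw [Pi.smul_apply]
    by_cases h : e = e' <;> cases b <;>
      simp only [hιdef, h, if_true, if_false, Bool.false_eq_true, Matrix.smul_apply, Complex.smul_re,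
        Complex.smul_im, smul_eq_mul, mul_zero]
  let ιl : Matrix (Fin (fundamentalLatticeRep 2).N) (Fin (fundamentalLatticeRep 2).N) ℂ →ₗ[ℝ] (Edge 3 L × Fin (fundamentalLatticeRep 2).N × Fin (fundamentalLatticeRep 2).N × Bool → ℝ) := { toFun := ι, map_add' := hιadd, map_smul' := hιsmul }
  let lam : Matrix (Fin (fundamentalLatticeRep 2).N) (Fin (fundamentalLatticeRep 2).N) ℂ →ₗ[ℝ] ℝ := (fderiv ℝ u ((fun (V : GaugeConfig 3 L (Matrix.specialUnitaryGroup (Fin 2) ℂ)) (q : Edge 3 L × Fin (fundamentalLatticeRep 2).N × Fin (fundamentalLatticeRep 2).N × Bool) => (fun z : ℂ => if q.2.2.2 then z.im else z.re) ((fundamentalRep (Fin 2) (V q.1) : Matrix (Fin 2) (Fin 2) ℂ) q.2.1 q.2.2.1)) V)).toLinearMap.comp ιl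
  have hlam : ∀ M, lam M = fderiv ℝ u ((fun (V : GaugeConfig 3 L (Matrix.specialUnitaryGroup (Fin 2) ℂ)) (q : Edge 3 L × Fin (fundamentalLatticeRep 2).N × Fin (fundamentalLatticeRep 2).N × Bool) => (fun z : ℂ => if q.2.2.2 then z.im else z.re) ((fundamentalRep (Fin 2) (V q.1) : Matrix (Fin 2) (Fin 2) ℂ) q.2.1 q.2.2.1)) V) (ι M) := fun M => rfl
  -- the noise frame at `e` read through `λ`
  have hreb := rebuild_coords_of (L := L) V
  have hRe : (fun (ee : Edge 3 L) => Matrix.of fun (i j : Fin (fundamentalLatticeRep 2).N) => (((fun (V : GaugeConfig 3 L (Matrix.specialUnitaryGroup (Fin 2) ℂ)) (q : Edge 3 L × Fin (fundamentalLatticeRep 2).N × Fin (fundamentalLatticeRep 2).N × Bool) => (fun z : ℂ => if q.2.2.2 then z.im else z.re) ((fundamentalRep (Fin 2) (V q.1) : Matrix (Fin 2) (Fin 2) ℂ) q.2.1 q.2.2.1)) V (ee, i, j, false) : ℝ) : ℂ) + (((fun (V : GaugeConfig 3 L (Matrix.specialUnitaryGroup (Fin 2) ℂ)) (q : Edge 3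 L × Fin (fundamentalLatticeRep 2).N × Fin (fundamentalLatticeRep 2).N × Bool) => (fun z : ℂ => if q.2.2.2 then z.im else z.re) ((fundamentalRep (Fin 2) (V q.1) : Matrix (Fin 2) (Fin 2) ℂ) q.2.1 q.2.2.1)) V (ee, i, j, true) : ℝ) : ℂ) * Complex.I) e = Q := congrFun hreb e
  have hW : ∀ ν : NoiseIdx (fundamentalLatticeRep 2).N,
      fderiv ℝ u ((fun (V : GaugeConfig 3 L (Matrix.specialUnitaryGroup (Fin 2) ℂ)) (q : Edge 3 L × Fin (fundamentalLatticeRep 2).N × Fin (fundamentalLatticeRep 2).N × Bool) => (fun z : ℂ => if q.2.2.2 then z.im else z.re) ((fundamentalRep (Fin 2) (V q.1) : Matrix (Fin 2) (Fin 2) ℂ) q.2.1 q.2.2.1)) V) (fun q : Edge 3 L × Fin (fundamentalLatticeRep 2).N × Fin (fundamentalLatticeRep 2).N × Bool => if (e, ν).1 = q.1 then (fun z : ℂ => if q.2.2.2 then z.im else z.re) (((Real.sqrt 2 : ℂ) • ((fundamentalLatticeRep 2).lieProj (noiseDir (e, ν).2) * (fun (ee : Edge 3 L) => Matrix.of fun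 (i j : Fin (fundamentalLatticeRep 2).N) => (((fun (V : GaugeConfig 3 L (Matrix.specialUnitaryGroup (Fin 2) ℂ)) (q : Edge 3 L × Fin (fundamentalLatticeRep 2).N × Fin (fundamentalLatticeRep 2).N × Bool) => (fun z : ℂ => if q.2.2.2 then z.im else z.re) ((fundamentalRep (Fin 2) (V q.1) : Matrix (Fin 2) (Fin 2) ℂ) q.2.1 q.2.2.1)) V (ee, i, j, false) : ℝ) : ℂ) + (((fun (V : GaugeConfig 3 L (Matrix.specialUnitaryGroup (Fin 2) ℂ)) (q : Edge 3 L × Fin (fundamentalLatticeRep 2).N × Fin (fundamentalLatticeRep 2).N × Bool) => (fun z : ℂ => if q.2.2.2 then z.im else z.re) ((fundamentalRep (Fin 2) (V q.1) : Matrix (Fin 2) (Fin 2) ℂ) q.2.1 q.2.2.1)) V (ee, i, j, true) : ℝ) : ℂ) * Complex.I) q.1)) q.2.1 q.2.2.1) else 0) = lam ((Real.sqrt 2 : ℂ) • ((fundamentalLatticeRep 2).lieProj (noiseDir ν) * Q)) := by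
    intro ν
    rw [hlam]
    congr 1
    funext q
    by_cases hq : e = q.1
    · have h1 : ((e, ν) : Edge 3 L × NoiseIdx (fundamentalLatticeRep 2).N).1 = q.1 := hq
      rw [if_pos h1, ← hq, hRe]
      simp only [hιdef, if_pos hq]
    · have h1 : ¬ ((e, ν) : Edge 3 L × NoiseIdx (fundamentalLatticeRep 2).N).1 = q.1 := hq
      rw [if_neg h1]
      simp only [hιdef, if_neg hq]
  -- `Σ_ν (W_(e,ν)u)² = 2 Σ_α λ(Q Y_α)² = 2 Σ_α λ(Y_α Q)²`
  have hsum : ∑ ν : NoiseIdx (fundamentalLatticeRep 2).N, fderiv ℝ u ((fun (V : GaugeConfig 3 L (Matrix.specialUnitaryGroup (Fin 2) ℂ)) (q : Edge 3 L × Fin (fundamentalLatticeRep 2).N × Fin (fundamentalLatticeRep 2).N × Bool) => (fun z : ℂ => if q.2.2.2 then z.im else z.re) ((fundamentalRep (Fin 2) (V q.1) : Matrix (Fin 2) (Fin 2) ℂ) q.2.1 q.2.2.1)) V) (fun q : Edge 3 L × Fin (fundamentalLatticeRep 2).N × Fin (fundamentalLatticeRep 2).N × Bool => if (e, ν).1 =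 q.1 then (fun z : ℂ => if q.2.2.2 then z.im else z.re) (((Real.sqrt 2 : ℂ) • ((fundamentalLatticeRep 2).lieProj (noiseDir (e, ν).2) * (fun (ee : Edge 3 L) => Matrix.of fun (i j : Fin (fundamentalLatticeRep 2).N) => (((fun (V : GaugeConfig 3 L (Matrix.specialUnitaryGroup (Fin 2) ℂ)) (q : Edge 3 L × Fin (fundamentalLatticeRep 2).N × Fin (fundamentalLatticeRep 2).N × Bool) => (fun z : ℂ => if q.2.2.2 then z.im else z.re) ((fundamentalRep (Fin 2) (V q.1) : Matrix (Fin 2) (Fin 2) ℂ) q.2.1 q.2.2.1)) V (ee, i, j, false) : ℝ) : ℂ) + (((fun (V : GaugeConfig 3 L (Matrix.specialUnitaryGroup (Fin 2) ℂ)) (q : Edge 3 L × Fin (fundamentalLatticeRep 2).N × Fin (fundamentalLatticeRep 2).N × Bool) => (fun z : ℂ => if q.2.2.2 then z.im else z.re) ((fundamentalRep (Fin 2) (V q.1) : Matrix (Fin 2) (Fin 2) ℂ) q.2.1 q.2.2.1)) V (ee, i, j, true) : ℝ) : ℂ) * Complex.I) q.1)) q.2.1 q.2.2.1) else 0) * fderiv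 ℝ u ((fun (V : GaugeConfig 3 L (Matrix.specialUnitaryGroup (Fin 2) ℂ)) (q : Edge 3 L × Fin (fundamentalLatticeRep 2).N × Fin (fundamentalLatticeRep 2).N × Bool) => (fun z : ℂ => if q.2.2.2 then z.im else z.re) ((fundamentalRep (Fin 2) (V q.1) : Matrix (Fin 2) (Fin 2) ℂ) q.2.1 q.2.2.1)) V) (fun q : Edge 3 L × Fin (fundamentalLatticeRep 2).N × Fin (fundamentalLatticeRep 2).N × Bool => if (e, ν).1 = q.1 then (fun z : ℂ => if q.2.2.2 then z.im else z.re) (((Real.sqrt 2 : ℂ) • ((fundamentalLatticeRep 2).lieProj (noiseDir (e, ν).2) * (fun (ee : Edge 3 L) => Matrix.of fun (i j : Fin (fundamentalLatticeRep 2).N) => (((fun (V : GaugeConfig 3 L (Matrix.specialUnitaryGroup (Fin 2) ℂ)) (q : Edge 3 L × Fin (fundamentalLatticeRep 2).N × Fin (fundamentalLatticeRep 2).N × Bool) => (fun z : ℂ => if q.2.2.2 then z.im else z.re) ((fundamentalRep (Fin 2) (V q.1) : Matrix (Fin 2) (Fin 2) ℂ) q.2.1 q.2.2.1)) V (ee,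 i, j, false) : ℝ) : ℂ) + (((fun (V : GaugeConfig 3 L (Matrix.specialUnitaryGroup (Fin 2) ℂ)) (q : Edge 3 L × Fin (fundamentalLatticeRep 2).N × Fin (fundamentalLatticeRep 2).N × Bool) => (fun z : ℂ => if q.2.2.2 then z.im else z.re) ((fundamentalRep (Fin 2) (V q.1) : Matrix (Fin 2) (Fin 2) ℂ) q.2.1 q.2.2.1)) V (ee, i, j, true) : ℝ) : ℂ) * Complex.I) q.1)) q.2.1 q.2.2.1) else 0) =
      2 * ∑ α : SUNBakryEmery.FrameIdx (fundamentalLatticeRep 2).N, lam (SUNBakryEmery.frame α * Q) ^ 2 := by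
    have h1 : ∑ ν : NoiseIdx (fundamentalLatticeRep 2).N, fderiv ℝ u ((fun (V : GaugeConfig 3 L (Matrix.specialUnitaryGroup (Fin 2) ℂ)) (q : Edge 3 L × Fin (fundamentalLatticeRep 2).N × Fin (fundamentalLatticeRep 2).N × Bool) => (fun z : ℂ => if q.2.2.2 then z.im else z.re) ((fundamentalRep (Fin 2) (V q.1) : Matrix (Fin 2) (Fin 2) ℂ) q.2.1 q.2.2.1)) V) (fun q : Edge 3 L × Fin (fundamentalLatticeRep 2).N × Fin (fundamentalLatticeRep 2).N × Bool => if (e, ν).1 = q.1 then (fun z : ℂ => if q.2.2.2 then z.im else z.re) (((Real.sqrt 2 : ℂ) • ((fundamentalLatticeRep 2).lieProj (noiseDir (e, ν).2) * (fun (ee : Edge 3 L) => Matrix.of fun (i j : Fin (fundamentalLatticeRep 2).N) => (((fun (V : GaugeConfig 3 L (Matrix.specialUnitaryGroup (Fin 2) ℂ)) (q : Edge 3 L × Fin (fundamentalLatticeRep 2).N × Fin (fundamentalLatticeRep 2).N × Bool) => (fun z : ℂ => if q.2.2.2 then z.im else z.re) ((fundamentalRep (Fin 2) (V q.1) : Matrix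 (Fin 2) (Fin 2) ℂ) q.2.1 q.2.2.1)) V (ee, i, j, false) : ℝ) : ℂ) + (((fun (V : GaugeConfig 3 L (Matrix.specialUnitaryGroup (Fin 2) ℂ)) (q : Edge 3 L × Fin (fundamentalLatticeRep 2).N × Fin (fundamentalLatticeRep 2).N × Bool) => (fun z : ℂ => if q.2.2.2 then z.im else z.re) ((fundamentalRep (Fin 2) (V q.1) : Matrix (Fin 2) (Fin 2) ℂ) q.2.1 q.2.2.1)) V (ee, i, j, true) : ℝ) : ℂ) * Complex.I) q.1)) q.2.1 q.2.2.1) else 0) * fderiv ℝ u ((fun (V : GaugeConfig 3 L (Matrix.specialUnitaryGroup (Fin 2) ℂ)) (q : Edge 3 L × Fin (fundamentalLatticeRep 2).N × Fin (fundamentalLatticeRep 2).N × Bool) => (fun z : ℂ => if q.2.2.2 then z.im else z.re) ((fundamentalRep (Fin 2) (V q.1) : Matrix (Fin 2) (Fin 2) ℂ) q.2.1 q.2.2.1)) V) (fun q : Edge 3 L × Fin (fundamentalLatticeRep 2).N × Fin (fundamentalLatticeRep 2).N × Bool => if (e, ν).1 = q.1 then (fun z : ℂ => if q.2.2.2 then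 z.im else z.re) (((Real.sqrt 2 : ℂ) • ((fundamentalLatticeRep 2).lieProj (noiseDir (e, ν).2) * (fun (ee : Edge 3 L) => Matrix.of fun (i j : Fin (fundamentalLatticeRep 2).N) => (((fun (V : GaugeConfig 3 L (Matrix.specialUnitaryGroup (Fin 2) ℂ)) (q : Edge 3 L × Fin (fundamentalLatticeRep 2).N × Fin (fundamentalLatticeRep 2).N × Bool) => (fun z : ℂ => if q.2.2.2 then z.im else z.re) ((fundamentalRep (Fin 2) (V q.1) : Matrix (Fin 2) (Fin 2) ℂ) q.2.1 q.2.2.1)) V (ee, i, j, false) : ℝ) : ℂ) + (((fun (V : GaugeConfig 3 L (Matrix.specialUnitaryGroup (Fin 2) ℂ)) (q : Edge 3 L × Fin (fundamentalLatticeRep 2).N × Fin (fundamentalLatticeRep 2).N × Bool) => (fun z : ℂ => if q.2.2.2 then z.im else z.re) ((fundamentalRep (Fin 2) (V q.1) : Matrix (Fin 2) (Fin 2) ℂ) q.2.1 q.2.2.1)) V (ee, i, j, true) : ℝ) : ℂ) * Complex.I) q.1)) q.2.1 q.2.2.1) else 0) =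
        ∑ ν : NoiseIdx 2, lam ((Real.sqrt 2 : ℂ) • ((fundamentalLatticeRep 2).lieProj (noiseDir ν) * Q)) ^ 2 :=
      Finset.sum_congr rfl fun ν _ => by rw [hW ν, sq]
    rw [h1, sum_sq_apply_noise_eq_two_mul_sum_sq_apply_mul_frame lam hQ1 hQ2,
      ← SUNBakryEmery.sum_sq_apply_frame_mul_eq_sum_sq_apply_mul_frame hN lam hQ1 hQ2]
  rw [hsum]
  -- `Σ_α λ(Y_α Q)² ≤ ℓ²` by the frame trick on `A ↦ λ(A Q)`
  have hkey : ∑ α : SUNBakryEmery.FrameIdx (fundamentalLatticeRep 2).N, lam (SUNBakryEmery.frame α * Q) ^ 2 ≤ ℓ ^ 2 := by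
    let lamQ : Matrix (Fin (fundamentalLatticeRep 2).N) (Fin (fundamentalLatticeRep 2).N) ℂ →ₗ[ℝ] ℝ := lam.comp (LinearMap.mulRight ℝ Q)
    have hlamQ : ∀ A, lamQ A = lam (A * Q) := fun A => rfl
    have h := sum_sq_apply_frame_le_of_skew hN lamQ (M := ℓ) (fun A hA hA0 => by
      rw [hlamQ, hlam]
      exact dirDeriv_abs_le_of_linkLipschitz hu e hA hA0 hℓ hLip V)
    simpa only [hlamQ] using h
  have h2 : (0 : ℝ) ≤ 2 := by norm_num
  exact mul_le_mul_of_nonneg_left hkey h2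

end Summit.QuantumFields.YangMills.Theorems.ColdStartUniversality
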